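import Literature.NumberTheory.Sieve.LinearEquationsInPrimesGvNLinearForms
import Mathlib.Algebra.Order.Chebyshev
import HarnessLib

/-!
# Dual functions and Gowers anti-uniformity (Green–Tao 2008, §6), for the transference of §10 of Green–Tao 2010

Trunk T-SIEVE (`Literature/NumberTheory/Sieve`). Part of the decomposition of
`Literature.NumberTheory.Sieve.GreenTao2010_gowersUniformity` (B. Green, T. Tao, *Linear
equations in primes*, Ann. of Math. 171 (2010), Thm. 7.2), layer "Prop. 10.1 ⇐ `GI(s)` +
Prop. 10.3" (§10, "A Koopman–von Neumann theorem"): Prop. 10.3 is Green–Tao 2008, Prop. 8.1,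
whose engine is the theory of *dual functions* of Green–Tao 2008, §6 ("Gowers anti-uniformity").
This file proves that theory, quantitatively, for the cyclic Gowers norms `‖·‖_{U^k(ℤ_M)}` of
`LinearEquationsInPrimesGowersCyclic.lean` and the pseudorandomness notions (Defs. 6.2–6.3 of
Green–Tao 2010) of `LinearEquationsInPrimesPseudorandom.lean`. Everything is proved:

* `Literature.NumberTheory.Sieve.gowersInner`, `Literature.NumberTheory.Sieve.gowersCauchySchwarz_cube` —
  the Gowers inner product `⟨(F_ω)⟩ = 𝔼_{x,h} ∏_ω F_ω(x + ω·h)` of a vertex family and the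
  Gowers–Cauchy–Schwarz inequality `|⟨(F_ω)⟩|^{2^k} ≤ ∏_ω ‖F_ω‖_{U^k}^{2^k}` in cube form (from the
  box-norm form `Literature.NumberTheory.Sieve.gowersCauchySchwarz`, App. B of Green–Tao 2010);
* `Literature.NumberTheory.Sieve.gdual` — the (generalised) dual function
  `𝒟G(x) = 𝔼_h ∏_{ω≠0} G_ω(x + ω·h)` ((6.3) of Green–Tao 2008 for a constant family), with
  `⟨f, 𝒟G⟩ = ⟨(f, G)⟩` (`expect_mul_gdual`), **Lemma 6.1**: `⟨F, 𝒟F⟩ = ‖F‖_{U^k}^{2^k}`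
  (`gowersPower_eq_expect_mul_gdual`), `|⟨f, 𝒟G⟩| ≤ ‖f‖ ∏_{ω≠0} ‖G_ω‖` (`abs_expect_mul_gdual_le`)
  and the boundedness (6.6) `|𝒟G| ≤ 2^{2^k-1}(1 + η)` for `|G_ω| ≤ ν + 1` under the linear forms
  condition (`abs_gdual_le`, via the cube systems with a common constant term `vertexSys`);
* **Lemma 6.3** (products of dual functions are Gowers anti-uniform), generalised to vertex
  families and made quantitative: `|⟨f, ∏_{j∈ι} 𝒟G_j⟩| ≤ ‖f‖_{U^k} (2^k-1)(1 + T_K(ν̃))` for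
  `ν̃`-dominated families, `T_K(ν̃) = 𝔼_h (𝔼_y ∏_ω ν̃(y + ω·h))^K`, `K = |ι|`
  (`Literature.NumberTheory.Sieve.abs_expect_mul_prod_gdual_le`; the printed change of variables
  `h^{(j)} = h + H^{(j)}`, Gowers–Cauchy–Schwarz for each `H`, the uniform covering `H ↦ ω·H`
  (`expect_vertexDot_eq`), domination and factorisation (`expect_majorant_eq_dualMoment`); the two
  Hölder steps of the source are replaced by the cruder `∏_{ω≠0} aᵥ ≤ ∑ aᵥ^{2^k-1} ≤ ∑ (1 + aᵥ^{2^k})`);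
* the moment bound `T_K(ν + 1) ≤ dualMomentBound k K A η` from the `D₀`-correlation condition
  ("the only time we will use that condition"; `Literature.NumberTheory.Sieve.dualMoment_add_one_le`,
  `expect_pow_corr_le`, the uniform covering `expect_vertexDiff_eq`) and `𝔼 ν ≤ 1 + η`
  (`expect_le_of_linearFormsCondition`), and the packaged orthogonality
  `|⟨ν - 1, ∏_j 𝒟G_j⟩| ≤ ‖ν - 1‖_{U^k} (2^k-1)(1 + dualMomentBound)`
  (`Literature.NumberTheory.Sieve.abs_expect_sub_one_mul_prod_gdual_le`) — the monomial case of
  Green–Tao 2008, Prop. 6.2, i.e. exactly the pseudorandomness hypothesis of the dense model theorem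
  (`Literature.Combinatorics.Additive.DenseModel.denseModel`) for the family of dual functions.

Parameters: with `k = s + 1` the cube systems have at most `2^k` forms in at most `k + 1`
variables with `0/±1` coefficients and the correlation condition is used with `m ≤ 2^k` shifts, so
everything holds for `D₀`-pseudorandom measures with `2^k ≤ D₀` — in particular for the
`(s+2)2^{s+1}`-pseudorandom measures of Props. 10.1 and 10.3 (these are Green–Tao 2008's parameters
`(k 2^{k-1}, 3k-4, k)` with `k = s + 2`).

## References

* B. Green, T. Tao, *The primes contain arbitrarily long arithmetic progressions*, Ann. of Math.
  (2) 167 (2008), 481–547 (arXiv:math/0404188), §6: (6.1) (dual norm), (6.3) (dual function),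
  Lemma 6.1 ((6.4)–(6.6)), Prop. 6.2, Lemma 6.3 and its proof. [cite: GreenTaoAnnals2008, §6]
* B. Green, T. Tao, *Linear equations in primes*, Ann. of Math. (2) 171 (2010), 1753–1850
  (arXiv:math/0606088): §10 (Prop. 10.3 and its proof: "`‖𝒟ν‖_{L^∞} ≤ 1 + o(1)` … a simple
  application of the linear forms condition"), Defs. 6.1–6.3, App. B ((B.5), Lemma B.2).
  [cite: GreenTao2010, §10 and App. B]
-/

noncomputable section

open Finset
open scoped BigOperators

namespace Literature.NumberTheory.Sieve

section cube

variable {M : ℕ} [NeZero M]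

/-- The Gowers cube product of a *family* of functions indexed by the vertices `ω ∈ {0,1}^k`
(`ω ⊆ [k]`): `∏_ω F_ω(x + ω·h)`. [cite: GreenTao2010, App. B, (B.5) and Lemma B.2] -/
def cubeProd (k : ℕ) (F : Finset (Fin k) → ZMod M → ℝ) (x : ZMod M) (h : Fin k → ZMod M) : ℝ :=
  ∏ ω : Finset (Fin k), F ω (x + ∑ j ∈ ω, h j)

/-- The Gowers inner product `⟨(F_ω)_ω⟩_{U^k(ℤ_M)} = 𝔼_{x,h} ∏_ω F_ω(x + ω·h)` of a vertex family
(real-valued, so no conjugations). [cite: GreenTao2010, App. B, (B.5)]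
[cite: GreenTaoAnnals2008, §6 (the Gowers inner product in the proof of Lemma 6.3)] -/
def gowersInner (k : ℕ) (F : Finset (Fin k) → ZMod M → ℝ) : ℝ :=
  𝔼 p : ZMod M × (Fin k → ZMod M), cubeProd k F p.1 p.2

omit [NeZero M] in
/-- A constant family has the Gowers cube product `gowersProd`. [folklore] -/
theorem cubeProd_const (k : ℕ) (g : ZMod M → ℝ) (x : ZMod M) (h : Fin k → ZMod M) :
    cubeProd k (fun _ => g) x h = gowersProd k g x h := rfl

/-- The inner product of a constant family is `‖g‖_{U^k}^{2^k}`. [cite: GreenTao2010, App. B] -/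
theorem gowersInner_const (k : ℕ) (g : ZMod M → ℝ) :
    gowersInner k (fun _ => g) = gowersPower k g := rfl

/-- The cube inner product as a box average over pairs `(x⁽⁰⁾, x⁽¹⁾) ∈ ℤ_M^k × ℤ_M^k` of the functions
`x ↦ F_ω(x₁ + ⋯ + x_k)` (substitute `x = ∑ x⁽⁰⁾_j`, `h = x⁽¹⁾ - x⁽⁰⁾`).
[cite: GreenTao2010, App. B (definition of `U^{s+1}(Z)` via box norms)] -/
theorem gowersInner_eq_expect_boxProd {k : ℕ} (hk : 1 ≤ k) (F : Finset (Fin k) → ZMod M → ℝ) :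
    gowersInner k F = 𝔼 p : (Fin k → ZMod M) × (Fin k → ZMod M),
      boxProd Finset.univ (fun ω (x : Fin k → ZMod M) => F ω (∑ j, x j)) p := by
  have hbox : ∀ p : (Fin k → ZMod M) × (Fin k → ZMod M),
      boxProd Finset.univ (fun ω (x : Fin k → ZMod M) => F ω (∑ j, x j)) p =
        cubeProd k F (∑ j, p.1 j) (p.2 - p.1) := by
    intro p
    unfold boxProd cubeProd
    rw [Finset.powerset_univ]
    refine Finset.prod_congr rfl fun ω _ => ?_
    have h := linear_mixPt_eq (0 : ZMod M) (fun _ => (1 : ZMod M)) p.1 p.2 ω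
    simp only [one_mul, zero_add] at h
    show F ω (∑ j, mixPt p.1 p.2 ω j) = _
    rw [h]
    rfl
  simp_rw [hbox]
  rw [expect_pair_sub (fun (x₀ h : Fin k → ZMod M) => cubeProd k F (∑ j, x₀ j) h), expect_prod_eq]
  have hu := expect_linear_uniform (fun z => 𝔼 h : Fin k → ZMod M, cubeProd k F z h) 0
    (a := fun _ => (1 : ZMod M)) (j₀ := ⟨0, hk⟩) isUnit_one
  simp only [one_mul, zero_add] at hu
  rw [hu]
  unfold gowersInner
  exact (expect_expect_eq_expect_prod _).symm

/-- **The Gowers–Cauchy–Schwarz inequality in cube form** (real-valued, `2^k`-th power form):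
`|⟨(F_ω)⟩|^{2^k} ≤ ∏_ω ‖F_ω‖_{U^k}^{2^k}`. [cite: GreenTao2010, App. B, Lemma B.2 and (B.5)]
[cite: GreenTaoAnnals2008, §5 (the Gowers–Cauchy–Schwarz inequality)] -/
theorem gowersCauchySchwarz_cube {k : ℕ} (hk : 1 ≤ k) (F : Finset (Fin k) → ZMod M → ℝ) :
    |gowersInner k F| ^ (2 ^ k) ≤ ∏ ω : Finset (Fin k), gowersPower k (F ω) := by
  have hA : (Finset.univ : Finset (Fin k)).Nonempty := ⟨⟨0, hk⟩, Finset.mem_univ _⟩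
  have h := gowersCauchySchwarz hA (fun ω (x : Fin k → ZMod M) => F ω (∑ j, x j))
  rw [Finset.card_univ, Fintype.card_fin, Finset.powerset_univ] at h
  rw [gowersInner_eq_expect_boxProd hk]
  refine h.trans (le_of_eq (Finset.prod_congr rfl fun ω _ => ?_))
  exact (gowersPower_eq_boxPower hk (F ω)).symm

/-- The Gowers–Cauchy–Schwarz inequality in cube form with roots:
`|⟨(F_ω)⟩| ≤ ∏_ω ‖F_ω‖_{U^k}`, `‖g‖_{U^k} = (‖g‖_{U^k}^{2^k})^{1/2^k}`. [cite: GreenTao2010, App. B, Lemma B.2] -/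
theorem abs_gowersInner_le {k : ℕ} (hk : 1 ≤ k) (F : Finset (Fin k) → ZMod M → ℝ) :
    |gowersInner k F| ≤ ∏ ω : Finset (Fin k), gowersPower k (F ω) ^ ((2 ^ k : ℕ) : ℝ)⁻¹ := by
  have hm0 : (2 ^ k : ℕ) ≠ 0 := by positivity
  rw [Real.finsetProd_rpow _ _ fun ω _ => gowersPower_nonneg hk _,
    ← Real.pow_rpow_inv_natCast (abs_nonneg (gowersInner k F)) hm0]
  exact Real.rpow_le_rpow (pow_nonneg (abs_nonneg _) _) (gowersCauchySchwarz_cube hk F)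
    (by positivity)

end cube

section dual

variable {M : ℕ} [NeZero M]

/-! ### Generalised dual functions (Green–Tao 2008, (6.3)) -/

/-- The **generalised dual function** of a vertex family `G = (G_ω)_{ω ≠ 0}`:
`𝒟G(x) = 𝔼_{h ∈ ℤ_M^k} ∏_{ω ∈ {0,1}^k, ω ≠ 0} G_ω(x + ω·h)`; for a constant family `G_ω = F` this is
the dual function `𝒟F` of (6.3) of Green–Tao 2008 (the value of `G` at `ω = ∅` is not read).
[cite: GreenTaoAnnals2008, §6, (6.3) (dual function) and the footnote on generalised dual functions] -/
def gdual (k : ℕ) (G : Finset (Fin k) → ZMod M → ℝ) (x : ZMod M) : ℝ :=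
  𝔼 h : Fin k → ZMod M, ∏ ω ∈ (Finset.univ : Finset (Finset (Fin k))).erase ∅, G ω (x + ∑ j ∈ ω, h j)

omit [NeZero M] in
/-- Splitting the cube product at the vertex `ω = 0`. [folklore] -/
theorem cubeProd_eq_mul_prod_erase (k : ℕ) (F : Finset (Fin k) → ZMod M → ℝ) (x : ZMod M)
    (h : Fin k → ZMod M) :
    cubeProd k F x h = F ∅ x * ∏ ω ∈ (Finset.univ : Finset (Finset (Fin k))).erase ∅,
      F ω (x + ∑ j ∈ ω, h j) := by
  unfold cubeProd
  rw [← Finset.mul_prod_erase _ _ (Finset.mem_univ ∅), Finset.sum_empty, add_zero]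

/-- **`⟨f, 𝒟G⟩` is a Gowers inner product**: `𝔼_x f(x) 𝒟G(x) = ⟨(f, (G_ω)_{ω≠0})⟩_{U^k}`.
[cite: GreenTaoAnnals2008, §6, proof of Lemma 6.1 ((6.4)–(6.5))] -/
theorem expect_mul_gdual (k : ℕ) (f : ZMod M → ℝ) (G : Finset (Fin k) → ZMod M → ℝ) :
    (𝔼 x, f x * gdual k G x) = gowersInner k (Function.update G ∅ f) := by
  unfold gowersInner
  rw [expect_prod_eq]
  refine Finset.expect_congr rfl fun x _ => ?_
  unfold gdual
  rw [Finset.mul_expect]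
  refine Finset.expect_congr rfl fun h _ => ?_
  rw [cubeProd_eq_mul_prod_erase, Function.update_self]
  congr 1
  exact Finset.prod_congr rfl fun ω hω => by rw [Function.update_of_ne (Finset.ne_of_mem_erase hω)]

/-- **`⟨F, 𝒟F⟩ = ‖F‖_{U^k}^{2^k}`**. [cite: GreenTaoAnnals2008, Lemma 6.1, (6.4)] -/
theorem gowersPower_eq_expect_mul_gdual (k : ℕ) (f : ZMod M → ℝ) :
    gowersPower k f = 𝔼 x, f x * gdual k (fun _ => f) x := by
  rw [expect_mul_gdual, ← gowersInner_const]
  congr 1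
  funext ω
  by_cases hω : ω = ∅
  · subst hω; rw [Function.update_self]
  · rw [Function.update_of_ne hω]

/-- **Dual functions obstruct uniformity**: `|⟨f, 𝒟G⟩| ≤ ‖f‖_{U^k} ∏_{ω≠0} ‖G_ω‖_{U^k}`
(Gowers–Cauchy–Schwarz). [cite: GreenTaoAnnals2008, Lemma 6.1, (6.5) and its proof] -/
theorem abs_expect_mul_gdual_le {k : ℕ} (hk : 1 ≤ k) (f : ZMod M → ℝ)
    (G : Finset (Fin k) → ZMod M → ℝ) :
    |𝔼 x, f x * gdual k G x| ≤ gowersPower k f ^ ((2 ^ k : ℕ) : ℝ)⁻¹ *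
      ∏ ω ∈ (Finset.univ : Finset (Finset (Fin k))).erase ∅, gowersPower k (G ω) ^ ((2 ^ k : ℕ) : ℝ)⁻¹ := by
  rw [expect_mul_gdual]
  refine (abs_gowersInner_le hk _).trans (le_of_eq ?_)
  rw [← Finset.mul_prod_erase _ _ (Finset.mem_univ ∅), Function.update_self]
  congr 1
  exact Finset.prod_congr rfl fun ω hω => by rw [Function.update_of_ne (Finset.ne_of_mem_erase hω)]

/-! ### Averages: products of independent averages, uniform coverings -/

/-- A product of independent averages is an average over the product space:
`∏_j 𝔼_y P_j(y) = 𝔼_{H ∈ Y^K} ∏_j P_j(H_j)`. [folklore] -/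
theorem prod_expect_eq_expect_pi {ι : Type*} [Fintype ι] [DecidableEq ι] {Y : Type*} [Fintype Y]
    [Nonempty Y] (P : ι → Y → ℝ) :
    ∏ j, (𝔼 y, P j y) = 𝔼 H : ι → Y, ∏ j, P j (H j) := by
  simp_rw [Finset.expect_eq_sum_div_card]
  rw [Finset.prod_div_distrib, Finset.prod_const, Finset.prod_univ_sum]
  simp only [Finset.card_univ, Fintype.card_pi, Finset.prod_const, Fintype.piFinset_univ,
    Nat.cast_pow]

/-- **Uniform covering by a non-zero vertex**: for `ω ≠ 0`, the map
`H = (H_j)_{j ∈ [K]} ↦ (ω·H_j)_j` pushes the uniform measure of `(ℤ_M^k)^K` forward to the uniform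
measure of `ℤ_M^K`. [cite: GreenTaoAnnals2008, §6, proof of Lemma 6.3 ("the map `H ↦ ω·H` is a uniform
covering")] -/
theorem expect_vertexDot_eq {k : ℕ} {ι : Type*} [Fintype ι] [DecidableEq ι] {ω : Finset (Fin k)}
    (hω : ω.Nonempty) (Φ : (ι → ZMod M) → ℝ) :
    (𝔼 H : ι → Fin k → ZMod M, Φ (fun j => ∑ i ∈ ω, H j i)) = 𝔼 u : ι → ZMod M, Φ u := by
  obtain ⟨i₀, hi₀⟩ := hω
  -- the bijection `H ↦ (H_j with H_j(i₀) := ω·H_j)_j`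
  let e : (ι → Fin k → ZMod M) ≃ (ι → Fin k → ZMod M) :=
    { toFun := fun H j => Function.update (H j) i₀ (∑ i ∈ ω, H j i)
      invFun := fun H j => Function.update (H j) i₀ (H j i₀ - ∑ i ∈ ω.erase i₀, H j i)
      left_inv := by
        intro H
        funext j
        dsimp only
        rw [Function.update_idem, Function.update_eq_iff]
        refine ⟨?_, fun i _ => rfl⟩
        rw [Function.update_self]
        have hs : ∑ i ∈ ω.erase i₀, Function.update (H j) i₀ (∑ i ∈ ω, H j i) i =
            ∑ i ∈ ω.erase i₀, H j i :=
          Finset.sum_congr rfl fun i hi => by rw [Function.update_of_ne (Finset.ne_of_mem_erase hi)]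
        rw [hs, ← Finset.add_sum_erase _ _ hi₀]
        ring
      right_inv := by
        intro H
        funext j
        dsimp only
        rw [Function.update_idem, Function.update_eq_iff]
        refine ⟨?_, fun i _ => rfl⟩
        rw [← Finset.add_sum_erase _ _ hi₀, Function.update_self]
        have hs : ∑ i ∈ ω.erase i₀, Function.update (H j) i₀ (H j i₀ - ∑ i ∈ ω.erase i₀, H j i) i =
            ∑ i ∈ ω.erase i₀, H j i :=
          Finset.sum_congr rfl fun i hi => by rw [Function.update_of_ne (Finset.ne_of_mem_erase hi)]
        rw [hs]
        ring }
  have h1 : (𝔼 H : ι → Fin k → ZMod M, Φ (fun j => ∑ i ∈ ω, H j i)) =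
      𝔼 H : ι → Fin k → ZMod M, Φ (fun j => e H j i₀) := by
    refine Finset.expect_congr rfl fun H _ => ?_
    congr 1
    funext j
    simp [e]
  rw [h1, expect_comp_equiv e (fun H' : ι → Fin k → ZMod M => Φ (fun j => H' j i₀))]
  -- the slice `H' ↦ (H'_j(i₀))_j` is uniformly distributed: swap the arguments and re-randomise `i₀`
  rw [← expect_comp_equiv (Equiv.piComm fun (_ : Fin k) (_ : ι) => ZMod M)
    (fun H' : ι → Fin k → ZMod M => Φ (fun j => H' j i₀))]
  have h2 : ∀ V : Fin k → ι → ZMod M,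
      Φ (fun j => (Equiv.piComm fun (_ : Fin k) (_ : ι) => ZMod M) V j i₀) = Φ (V i₀) := by
    intro V; rfl
  simp_rw [h2]
  rw [← expect_expect_update i₀ (fun V : Fin k → ι → ZMod M => Φ (V i₀))]
  simp only [Function.update_self, Fintype.expect_const]

end dual

section antiuniform

variable {M : ℕ} [NeZero M]

/-! ### Products of dual functions are Gowers anti-uniform (Green–Tao 2008, Lemma 6.3) -/

/-- `t^θ ≤ 1 + t` for `t ≥ 0` and `0 ≤ θ ≤ 1`. [folklore] -/
theorem rpow_le_one_add {t θ : ℝ} (ht : 0 ≤ t) (hθ0 : 0 ≤ θ) (hθ1 : θ ≤ 1) : t ^ θ ≤ 1 + t := by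
  rcases le_or_gt t 1 with h | h
  · exact (Real.rpow_le_one ht h hθ0).trans (le_add_of_nonneg_right ht)
  · calc t ^ θ ≤ t ^ (1 : ℝ) := Real.rpow_le_rpow_of_exponent_le h.le hθ1
      _ = t := Real.rpow_one t
      _ ≤ 1 + t := le_add_of_nonneg_left zero_le_one

/-- A product of `m` non-negative reals is at most the sum of their `m`-th powers (bound each
factor by the largest). [folklore] -/
theorem prod_le_sum_pow_card {ι : Type*} (s : Finset ι) (hs : s.Nonempty) (x : ι → ℝ)
    (hx : ∀ i ∈ s, 0 ≤ x i) : ∏ i ∈ s, x i ≤ ∑ i ∈ s, x i ^ s.card := by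
  obtain ⟨i₀, hi₀, hmax⟩ := Finset.exists_max_image s x hs
  calc ∏ i ∈ s, x i ≤ ∏ _i ∈ s, x i₀ := Finset.prod_le_prod (fun i hi => hx i hi) fun i hi => hmax i hi
    _ = x i₀ ^ s.card := Finset.prod_const _
    _ ≤ ∑ i ∈ s, x i ^ s.card :=
        Finset.single_le_sum (f := fun i => x i ^ s.card) (fun i hi => pow_nonneg (hx i hi) _) hi₀

/-- The vertex family of the proof of Lemma 6.3 of Green–Tao 2008 for a shift
`H = (H_j)_{j ∈ [K]} ∈ (ℤ_M^k)^K`: `f` at `ω = 0` and `g_{ω·H}(y) = ∏_j G_{j,ω}(y + ω·H_j)` at `ω ≠ 0`.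
[cite: GreenTaoAnnals2008, §6, proof of Lemma 6.3 (the functions `g_{u^{(1)},…,u^{(K)}}`)] -/
def shiftFamily (k : ℕ) {ι : Type*} [Fintype ι] (f : ZMod M → ℝ)
    (G : ι → Finset (Fin k) → ZMod M → ℝ) (H : ι → Fin k → ZMod M) :
    Finset (Fin k) → ZMod M → ℝ :=
  Function.update (fun ω y => ∏ j, G j ω (y + ∑ i ∈ ω, H j i)) ∅ f

/-- **`⟨f, ∏_j 𝒟G_j⟩` as an average of Gowers inner products** (the change of variables
`h^{(j)} = h + H^{(j)}` of the proof of Lemma 6.3 of Green–Tao 2008):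
`𝔼_x f(x) ∏_j 𝒟G_j(x) = 𝔼_H ⟨(f, (g_{ω·H})_{ω ≠ 0})⟩_{U^k}`.
[cite: GreenTaoAnnals2008, §6, proof of Lemma 6.3] -/
theorem expect_mul_prod_gdual_eq (k : ℕ) {ι : Type*} [Fintype ι] [DecidableEq ι] (f : ZMod M → ℝ)
    (G : ι → Finset (Fin k) → ZMod M → ℝ) :
    (𝔼 x, f x * ∏ j, gdual k (G j) x) =
      𝔼 H : ι → Fin k → ZMod M, gowersInner k (shiftFamily k f G H) := by
  set P : ι → ZMod M → (Fin k → ZMod M) → ℝ :=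
    fun j x h => ∏ ω ∈ (Finset.univ : Finset (Finset (Fin k))).erase ∅, G j ω (x + ∑ i ∈ ω, h i)
    with hP
  -- products of independent averages, and the shift `H ↦ h + H`
  have h1 : ∀ x, ∏ j, gdual k (G j) x = 𝔼 H : ι → Fin k → ZMod M, ∏ j, P j x (H j) :=
    fun x => prod_expect_eq_expect_pi (fun j h => P j x h)
  have h3 : ∀ x, (𝔼 H : ι → Fin k → ZMod M, ∏ j, P j x (H j)) =
      𝔼 h : Fin k → ZMod M, 𝔼 H : ι → Fin k → ZMod M, ∏ j, P j x (h + H j) := by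
    intro x
    have : ∀ h : Fin k → ZMod M, (𝔼 H : ι → Fin k → ZMod M, ∏ j, P j x (h + H j)) =
        𝔼 H : ι → Fin k → ZMod M, ∏ j, P j x (H j) := fun h =>
      expect_comp_equiv (Equiv.piCongrRight fun _ : ι => Equiv.addLeft h)
        (fun H : ι → Fin k → ZMod M => ∏ j, P j x (H j))
    simp_rw [this]
    rw [Fintype.expect_const]
  calc (𝔼 x, f x * ∏ j, gdual k (G j) x)
      = 𝔼 x, 𝔼 h : Fin k → ZMod M, 𝔼 H : ι → Fin k → ZMod M, f x * ∏ j, P j x (h + H j) := by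
        refine Finset.expect_congr rfl fun x _ => ?_
        rw [h1 x, h3 x, Finset.mul_expect]
        refine Finset.expect_congr rfl fun h _ => ?_
        rw [Finset.mul_expect]
    _ = 𝔼 x, 𝔼 H : ι → Fin k → ZMod M, 𝔼 h : Fin k → ZMod M, f x * ∏ j, P j x (h + H j) := by
        refine Finset.expect_congr rfl fun x _ => ?_
        exact Finset.expect_comm _ _ _
    _ = 𝔼 H : ι → Fin k → ZMod M, 𝔼 x, 𝔼 h : Fin k → ZMod M, f x * ∏ j, P j x (h + H j) :=
        Finset.expect_comm _ _ _
    _ = 𝔼 H : ι → Fin k → ZMod M, gowersInner k (shiftFamily k f G H) := by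
        refine Finset.expect_congr rfl fun H _ => ?_
        unfold gowersInner
        rw [expect_prod_eq]
        refine Finset.expect_congr rfl fun x _ => Finset.expect_congr rfl fun h _ => ?_
        rw [cubeProd_eq_mul_prod_erase]
        unfold shiftFamily
        rw [Function.update_self]
        congr 1
        rw [hP]
        dsimp only
        rw [Finset.prod_comm]
        refine Finset.prod_congr rfl fun ω hω => ?_
        rw [Function.update_of_ne (Finset.ne_of_mem_erase hω)]
        refine Finset.prod_congr rfl fun j _ => ?_
        congr 1
        simp only [Pi.add_apply, Finset.sum_add_distrib, add_assoc]

/-- The moment `T_K(ν̃) = 𝔼_{h ∈ ℤ_M^k} (𝔼_y ∏_{ω} ν̃(y + ω·h))^K` controlling products of `K` dual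
functions of `ν̃`-dominated families. [cite: GreenTaoAnnals2008, §6, proof of Lemma 6.3 (last display
before the correlation condition)] -/
def dualMoment (k K : ℕ) (νt : ZMod M → ℝ) : ℝ :=
  𝔼 h : Fin k → ZMod M, (𝔼 y, gowersProd k νt y h) ^ K

/-- The majorant `R(u) = 𝔼_{y,h} ∏_ω ∏_j ν̃(y + ω·h + u_j)` of `‖g_u‖_{U^k}^{2^k}`, and its average
`𝔼_u R(u) = T_K(ν̃)` (factorise the `u_j`-averages). [cite: GreenTaoAnnals2008, §6, proof of Lemma 6.3] -/
theorem expect_majorant_eq_dualMoment (k : ℕ) {ι : Type*} [Fintype ι] [DecidableEq ι]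
    (νt : ZMod M → ℝ) :
    (𝔼 u : ι → ZMod M, 𝔼 p : ZMod M × (Fin k → ZMod M),
      ∏ ω : Finset (Fin k), ∏ j, νt (p.1 + ∑ i ∈ ω, p.2 i + u j)) =
      dualMoment k (Fintype.card ι) νt := by
  set Q : ZMod M × (Fin k → ZMod M) → ZMod M → ℝ :=
    fun p v => ∏ ω : Finset (Fin k), νt (p.1 + ∑ i ∈ ω, p.2 i + v) with hQ
  have hswap : ∀ (u : ι → ZMod M) (p : ZMod M × (Fin k → ZMod M)),
      ∏ ω : Finset (Fin k), ∏ j, νt (p.1 + ∑ i ∈ ω, p.2 i + u j) = ∏ j, Q p (u j) := by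
    intro u p
    rw [Finset.prod_comm]
  simp_rw [hswap]
  rw [Finset.expect_comm]
  unfold dualMoment
  rw [expect_prod_eq]
  have hy : ∀ y : ZMod M, (𝔼 h : Fin k → ZMod M, 𝔼 u : ι → ZMod M, ∏ j, Q (y, h) (u j)) =
      𝔼 h : Fin k → ZMod M, (𝔼 v, gowersProd k νt v h) ^ Fintype.card ι := by
    intro y
    refine Finset.expect_congr rfl fun h _ => ?_
    rw [← prod_expect_eq_expect_pi (fun _ v => Q (y, h) v), Finset.prod_const, Finset.card_univ]
    congr 1
    have hQ' : ∀ v, Q (y, h) v = gowersProd k νt (v + y) h := by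
      intro v
      rw [hQ]
      unfold gowersProd
      dsimp only
      refine Finset.prod_congr rfl fun ω _ => ?_
      congr 1
      abel
    simp_rw [hQ']
    exact expect_add_right (fun v => gowersProd k νt v h) y
  simp_rw [hy]
  rw [Fintype.expect_const]

/-- **Products of dual functions are Gowers anti-uniform** (Green–Tao 2008, Lemma 6.3, in the
generalised and quantitative form used here: "`‖∏_{j=1}^K 𝒟F_j‖_{(U^{k-1})^*} = O_K(1)`", the
implied constant coming from the correlation condition). For vertex families `G_j` dominated by
`ν̃ ≥ 0` and any `f`,
`|⟨f, ∏_j 𝒟G_j⟩| ≤ ‖f‖_{U^k} · (2^k - 1)(1 + T_K(ν̃))`, `T_K(ν̃) = 𝔼_h (𝔼_y ∏_ω ν̃(y + ω·h))^K`.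
The printed proof: the change of variables `h^{(j)} = h + H^{(j)}`, Gowers–Cauchy–Schwarz for each
`H`, the uniform covering `H ↦ ω·H`, domination by `ν̃` and factorisation; in place of the two
Hölder steps we bound `∏_{ω≠0} ‖g_{ω·H}‖ ≤ ∑_{ω≠0} ‖g_{ω·H}‖^{2^k-1} ≤ ∑_{ω≠0} (1 + ‖g_{ω·H}‖^{2^k})`.
[cite: GreenTaoAnnals2008, §6, Lemma 6.3 and its proof] -/
theorem abs_expect_mul_prod_gdual_le {k : ℕ} (hk : 1 ≤ k) {ι : Type*} [Fintype ι] [DecidableEq ι]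
    (f : ZMod M → ℝ) (G : ι → Finset (Fin k) → ZMod M → ℝ) {νt : ZMod M → ℝ}
    (hG : ∀ j ω x, |G j ω x| ≤ νt x) :
    |𝔼 x, f x * ∏ j, gdual k (G j) x| ≤
      gowersPower k f ^ ((2 ^ k : ℕ) : ℝ)⁻¹ *
        ((2 ^ k - 1 : ℕ) * (1 + dualMoment k (Fintype.card ι) νt)) := by
  set nf : ℝ := gowersPower k f ^ ((2 ^ k : ℕ) : ℝ)⁻¹ with hnf
  have hnf0 : 0 ≤ nf := Real.rpow_nonneg (gowersPower_nonneg hk f) _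
  set R : (ι → ZMod M) → ℝ := fun u => 𝔼 p : ZMod M × (Fin k → ZMod M),
    ∏ ω : Finset (Fin k), ∏ j, νt (p.1 + ∑ i ∈ ω, p.2 i + u j) with hR
  set V : Finset (Finset (Fin k)) := (Finset.univ : Finset (Finset (Fin k))).erase ∅ with hV
  have hVcard : V.card = 2 ^ k - 1 := by
    rw [hV, Finset.card_erase_of_mem (Finset.mem_univ _), Finset.card_univ, Fintype.card_finset,
      Fintype.card_fin]
  have hVne : V.Nonempty := by
    refine ⟨Finset.univ, Finset.mem_erase.mpr ⟨?_, Finset.mem_univ _⟩⟩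
    exact Finset.nonempty_iff_ne_empty.mp ⟨⟨0, hk⟩, Finset.mem_univ _⟩
  -- the functions `g_{ω,H}` and the domination `‖g_{ω,H}‖^{2^k} ≤ R(ω·H)`
  set g : Finset (Fin k) → (ι → Fin k → ZMod M) → ZMod M → ℝ :=
    fun ω H y => ∏ j, G j ω (y + ∑ i ∈ ω, H j i) with hg
  have hgR : ∀ ω H, gowersPower k (g ω H) ≤ R (fun j => ∑ i ∈ ω, H j i) := by
    intro ω H
    unfold gowersPower
    refine (le_abs_self _).trans ((Finset.abs_expect_le _ _).trans
      (Finset.expect_le_expect fun p _ => ?_))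
    unfold gowersProd
    rw [Finset.abs_prod]
    refine Finset.prod_le_prod (fun ω' _ => abs_nonneg _) fun ω' _ => ?_
    rw [hg]
    dsimp only
    rw [Finset.abs_prod]
    refine Finset.prod_le_prod (fun j _ => abs_nonneg _) fun j _ => ?_
    exact hG j ω _
  -- pointwise in `H`
  have hpt : ∀ H : ι → Fin k → ZMod M, |gowersInner k (shiftFamily k f G H)| ≤
      nf * ∑ ω ∈ V, (1 + R (fun j => ∑ i ∈ ω, H j i)) := by
    intro H
    refine (abs_gowersInner_le hk _).trans ?_
    rw [← Finset.mul_prod_erase _ _ (Finset.mem_univ ∅)]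
    have h0 : shiftFamily k f G H ∅ = f := by
      unfold shiftFamily; rw [Function.update_self]
    have hωg : ∀ ω ∈ V, shiftFamily k f G H ω = g ω H := fun ω hω => by
      unfold shiftFamily; rw [Function.update_of_ne (Finset.ne_of_mem_erase hω)]
    rw [h0, ← hV]
    refine mul_le_mul_of_nonneg_left ?_ hnf0
    rw [Finset.prod_congr rfl fun ω hω => by rw [hωg ω hω]]
    -- `∏_{ω≠0} ‖g_{ω,H}‖ ≤ ∑_{ω≠0} ‖g_{ω,H}‖^{2^k-1} ≤ ∑_{ω≠0} (1 + ‖g_{ω,H}‖^{2^k})`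
    refine (prod_le_sum_pow_card V hVne _ fun ω _ =>
      Real.rpow_nonneg (gowersPower_nonneg hk _) _).trans (Finset.sum_le_sum fun ω _ => ?_)
    have hgp0 : 0 ≤ gowersPower k (g ω H) := gowersPower_nonneg hk _
    rw [← Real.rpow_natCast, ← Real.rpow_mul hgp0]
    refine (rpow_le_one_add hgp0 (by positivity) ?_).trans (by linarith [hgR ω H])
    rw [hVcard, inv_mul_le_iff₀ (by positivity), mul_one]
    exact_mod_cast Nat.sub_le _ _
  -- average over `H`
  rw [expect_mul_prod_gdual_eq]
  refine (Finset.abs_expect_le _ _).trans ((Finset.expect_le_expect fun H _ => hpt H).trans ?_)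
  rw [← Finset.mul_expect]
  refine mul_le_mul_of_nonneg_left ?_ hnf0
  rw [Finset.expect_sum_comm]
  have hterm : ∀ ω ∈ V, (𝔼 H : ι → Fin k → ZMod M, (1 + R fun j => ∑ i ∈ ω, H j i)) =
      1 + dualMoment k (Fintype.card ι) νt := by
    intro ω hω
    rw [Finset.expect_add_distrib, Fintype.expect_const]
    congr 1
    have hne : ω.Nonempty := Finset.nonempty_iff_ne_empty.mpr (Finset.ne_of_mem_erase hω)
    rw [expect_vertexDot_eq hne R, hR]
    exact expect_majorant_eq_dualMoment k νt
  rw [Finset.sum_congr rfl hterm, Finset.sum_const, nsmul_eq_mul, hVcard]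

end antiuniform

section linearforms

variable {M : ℕ} [NeZero M]

/-! ### Consequences of the linear forms condition: `𝔼 ν`, and the boundedness of dual functions -/

/-- The one-form system `ψ(n) = n`. [cite: GreenTao2010, Def. 6.1 and the Remark after Def. 6.2] -/
def idSys : IntFormSys Unit Unit where
  coeff _ _ := 1
  const _ := 0

/-- **`|𝔼 ν - 1| ≤ η`** under the linear forms condition (the case `d = t = 1`, `ψ(n) = n` of
(6.2): "a measure … with `𝔼 ν = 1 + o(1)`"). [cite: GreenTao2010, Def. 6.1 and the Remark after
Def. 6.2] -/
theorem abs_expect_sub_one_le_of_linearFormsCondition {D₀ : ℕ} {η : ℝ} {ν : ZMod M → ℝ}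
    (hLFC : LinearFormsCondition D₀ D₀ D₀ η ν) (hD : 1 ≤ D₀) : |(𝔼 x, ν x) - 1| ≤ η := by
  have hfc : idSys.FiniteComplexity := fun φ φ' hne => absurd (Subsingleton.elim φ φ') hne
  have hnz : idSys.Nonzero := fun φ h0 => by
    have := congr_fun h0 ()
    simp [idSys] at this
  have hbd : idSys.CoeffBound 1 := fun φ c => by simp [idSys]
  have h := idSys.abs_expect_prod_sub_one_le hLFC hfc hnz hbd hD
    (by rw [Fintype.card_unit]) (by rw [Fintype.card_unit]; exact hD)
    (by rw [Fintype.card_unit]) (by rw [Fintype.card_unit]; exact hD)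
  have heval : ∀ v : Unit → ZMod M, ∏ φ : Unit, ν (idSys.evalZ M φ v) = ν (v ()) := by
    intro v
    rw [Fintype.prod_unique]
    simp [IntFormSys.evalZ, idSys]
  simp_rw [heval] at h
  have he : (𝔼 i : Unit → ZMod M, ν (i ())) = 𝔼 x, ν x :=
    expect_comp_equiv (Equiv.funUnique Unit (ZMod M)) ν
  rwa [he] at h

/-- `𝔼 ν ≤ 1 + η` under the linear forms condition. [cite: GreenTao2010, Def. 6.1] -/
theorem expect_le_of_linearFormsCondition {D₀ : ℕ} {η : ℝ} {ν : ZMod M → ℝ}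
    (hLFC : LinearFormsCondition D₀ D₀ D₀ η ν) (hD : 1 ≤ D₀) : (𝔼 x, ν x) ≤ 1 + η := by
  linarith [(abs_le.mp (abs_expect_sub_one_le_of_linearFormsCondition hLFC hD)).2]

/-- The system of cube forms `h ↦ c + ω·h`, `ω ∈ S ⊆ {0,1}^k ∖ {0}`, in the variables `h ∈ ℤ^k`
with a common constant term `c` (the forms of (6.6): "here, all the `b_i` are equal to `x`").
[cite: GreenTaoAnnals2008, §6, proof of Lemma 6.1 ((6.6))] -/
def vertexSys (k : ℕ) (S : Finset (Finset (Fin k))) (c : ℤ) : IntFormSys S (Fin k) where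
  coeff ω j := if j ∈ (ω : Finset (Fin k)) then 1 else 0
  const _ := c

omit [NeZero M] in
/-- The forms of `vertexSys`: `c + ∑_{j ∈ ω} h_j`. [folklore] -/
theorem vertexSys_evalZ {k : ℕ} (S : Finset (Finset (Fin k))) (c : ℤ) (ω : S)
    (h : Fin k → ZMod M) :
    (vertexSys k S c).evalZ M ω h = (c : ZMod M) + ∑ j ∈ (ω : Finset (Fin k)), h j := by
  unfold IntFormSys.evalZ vertexSys
  dsimp only
  rw [add_comm]
  congr 1
  have : ∀ j : Fin k, ((if j ∈ (ω : Finset (Fin k)) then (1 : ℤ) else 0 : ℤ) : ZMod M) * h j =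
      if j ∈ (ω : Finset (Fin k)) then h j else 0 := fun j => by
    split_ifs <;> simp
  simp_rw [this]
  rw [Finset.sum_ite_mem, Finset.univ_inter]

/-- `vertexSys` has finite complexity when `0 ∉ S` (distinct non-zero `0/1`-vectors are never
parallel). [cite: GreenTaoAnnals2008, §6, proof of Lemma 6.1] -/
theorem vertexSys_fc {k : ℕ} {S : Finset (Finset (Fin k))} (hS : ∅ ∉ S) (c : ℤ) :
    (vertexSys k S c).FiniteComplexity := by
  intro ω ω' hne a b hab
  have hne' : (ω : Finset (Fin k)) ≠ (ω' : Finset (Fin k)) := fun e => hne (Subtype.ext e)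
  have hωne : (ω : Finset (Fin k)).Nonempty :=
    Finset.nonempty_iff_ne_empty.mpr fun e => hS (e ▸ ω.2)
  have hω'ne : (ω' : Finset (Fin k)).Nonempty :=
    Finset.nonempty_iff_ne_empty.mpr fun e => hS (e ▸ ω'.2)
  have hab' : ∀ j : Fin k, a * (if j ∈ (ω : Finset (Fin k)) then 1 else 0) =
      b * (if j ∈ (ω' : Finset (Fin k)) then 1 else 0) := fun j => by
    have := congr_fun hab j
    simpa [vertexSys] using this
  obtain ⟨j, hj⟩ : ∃ j, ¬ (j ∈ (ω : Finset (Fin k)) ↔ j ∈ (ω' : Finset (Fin k))) := by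
    by_contra hall
    push Not at hall
    exact hne' (Finset.ext hall)
  by_cases hjω : j ∈ (ω : Finset (Fin k))
  · have hjω' : j ∉ (ω' : Finset (Fin k)) := fun h' => hj ⟨fun _ => h', fun _ => hjω⟩
    have ha : a = 0 := by simpa [hjω, hjω'] using hab' j
    obtain ⟨j', hj'⟩ := hω'ne
    have hb : b = 0 := by
      have := hab' j'
      rw [ha, zero_mul] at this
      simpa [hj'] using this.symm
    exact ⟨ha, hb⟩
  · have hjω' : j ∈ (ω' : Finset (Fin k)) := by
      by_contra h'
      exact hj ⟨fun h => absurd h hjω, fun h => absurd h h'⟩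
    have hb : b = 0 := by simpa [hjω, hjω'] using (hab' j).symm
    obtain ⟨j', hj'⟩ := hωne
    have ha : a = 0 := by
      have := hab' j'
      rw [hb, zero_mul] at this
      simpa [hj'] using this
    exact ⟨ha, hb⟩

/-- `vertexSys` has non-constant forms when `0 ∉ S`. [folklore] -/
theorem vertexSys_nz {k : ℕ} {S : Finset (Finset (Fin k))} (hS : ∅ ∉ S) (c : ℤ) :
    (vertexSys k S c).Nonzero := by
  intro ω h0
  have hωne : (ω : Finset (Fin k)).Nonempty :=
    Finset.nonempty_iff_ne_empty.mpr fun e => hS (e ▸ ω.2)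
  obtain ⟨j, hj⟩ := hωne
  have := congr_fun h0 j
  simp [vertexSys, hj] at this

/-- `vertexSys` has `0/1` coefficients. [folklore] -/
theorem vertexSys_bound {k : ℕ} (S : Finset (Finset (Fin k))) (c : ℤ) :
    (vertexSys k S c).CoeffBound 1 := by
  intro ω j
  simp only [vertexSys]
  split_ifs <;> simp

/-- **The linear forms condition for cube forms with a common constant term**: for
`∅ ≠ S ⊆ {0,1}^k ∖ {0}` with `|S|, k ≤ D₀`, `𝔼_{h ∈ ℤ_M^k} ∏_{ω ∈ S} ν(x + ω·h) ≤ 1 + η`, uniformly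
in `x` ("this is the only place in the paper that we appeal to the linear forms condition in the
non-homogeneous case where some `b_i ≠ 0`"). [cite: GreenTaoAnnals2008, §6, proof of Lemma 6.1 ((6.6))] -/
theorem expect_prod_vertex_le {D₀ : ℕ} {η : ℝ} {ν : ZMod M → ℝ}
    (hLFC : LinearFormsCondition D₀ D₀ D₀ η ν) {k : ℕ} (hk : 1 ≤ k) (hkD : k ≤ D₀)
    {S : Finset (Finset (Fin k))} (hS : ∅ ∉ S) (hSne : S.Nonempty) (hSD : S.card ≤ D₀)
    (x : ZMod M) :
    (𝔼 h : Fin k → ZMod M, ∏ ω ∈ S, ν (x + ∑ j ∈ ω, h j)) ≤ 1 + η := by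
  have hD : 1 ≤ D₀ := hk.trans hkD
  have h := (vertexSys k S (x.val : ℤ)).abs_expect_prod_sub_one_le hLFC (vertexSys_fc hS _)
    (vertexSys_nz hS _) (vertexSys_bound S _) hD
    (by rw [Fintype.card_coe]; exact hSne.card_pos) (by rw [Fintype.card_coe]; exact hSD)
    (by rw [Fintype.card_fin]; exact hk) (by rw [Fintype.card_fin]; exact hkD)
  have heval : ∀ h : Fin k → ZMod M, ∏ φ : S, ν ((vertexSys k S (x.val : ℤ)).evalZ M φ h) =
      ∏ ω ∈ S, ν (x + ∑ j ∈ ω, h j) := by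
    intro h
    rw [← Finset.prod_coe_sort S]
    refine Finset.prod_congr rfl fun ω _ => ?_
    rw [vertexSys_evalZ, Int.cast_natCast, ZMod.natCast_zmod_val]
  simp_rw [heval] at h
  linarith [(abs_le.mp h).2]

/-- **Boundedness of dual functions** (Green–Tao 2008, Lemma 6.1, (6.6), generalised to vertex
families): if `|G_ω| ≤ ν + 1` pointwise and `ν` satisfies the `(D₀,D₀,D₀)`-linear forms condition
with error `η`, `2^k ≤ D₀`, then `|𝒟G(x)| ≤ 2^{2^k-1}(1 + η)` for every `x` (expand
`∏_{ω≠0} (ν + 1)(x + ω·h)` over subsets of the non-zero vertices and apply (6.2) to each).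
[cite: GreenTaoAnnals2008, Lemma 6.1, (6.6) and its proof] -/
theorem abs_gdual_le {D₀ : ℕ} {η : ℝ} {ν : ZMod M → ℝ} (hLFC : LinearFormsCondition D₀ D₀ D₀ η ν)
    (hη : 0 ≤ η) {k : ℕ} (hk : 1 ≤ k) (h2k : 2 ^ k ≤ D₀)
    (G : Finset (Fin k) → ZMod M → ℝ) (hG : ∀ ω x, |G ω x| ≤ ν x + 1) (x : ZMod M) :
    |gdual k G x| ≤ 2 ^ (2 ^ k - 1) * (1 + η) := by
  have hkD : k ≤ D₀ := (Nat.lt_two_pow_self).le.trans h2k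
  set V : Finset (Finset (Fin k)) := (Finset.univ : Finset (Finset (Fin k))).erase ∅ with hV
  have hVcard : V.card = 2 ^ k - 1 := by
    rw [hV, Finset.card_erase_of_mem (Finset.mem_univ _), Finset.card_univ, Fintype.card_finset,
      Fintype.card_fin]
  unfold gdual
  rw [← hV]
  calc |𝔼 h : Fin k → ZMod M, ∏ ω ∈ V, G ω (x + ∑ j ∈ ω, h j)|
      ≤ 𝔼 h : Fin k → ZMod M, ∏ ω ∈ V, (ν (x + ∑ j ∈ ω, h j) + 1) := by
        refine (Finset.abs_expect_le _ _).trans (Finset.expect_le_expect fun h _ => ?_)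
        rw [Finset.abs_prod]
        exact Finset.prod_le_prod (fun ω _ => abs_nonneg _) fun ω _ => hG ω _
    _ = ∑ S ∈ V.powerset, 𝔼 h : Fin k → ZMod M, ∏ ω ∈ S, ν (x + ∑ j ∈ ω, h j) := by
        simp_rw [Finset.prod_add, Finset.prod_const_one, mul_one]
        exact Finset.expect_sum_comm _ _ _
    _ ≤ ∑ _S ∈ V.powerset, (1 + η) := by
        refine Finset.sum_le_sum fun S hS => ?_
        have hSV : S ⊆ V := Finset.mem_powerset.mp hS
        rcases S.eq_empty_or_nonempty with rfl | hSne
        · simp only [Finset.prod_empty, Fintype.expect_const]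
          linarith
        · have h0S : ∅ ∉ S := fun h0 => Finset.ne_of_mem_erase (hSV h0) rfl
          refine expect_prod_vertex_le hLFC hk hkD h0S hSne ?_ x
          calc S.card ≤ V.card := Finset.card_le_card hSV
            _ ≤ 2 ^ k := by rw [hVcard]; exact Nat.sub_le _ _
            _ ≤ D₀ := h2k
    _ = 2 ^ (2 ^ k - 1) * (1 + η) := by
        rw [Finset.sum_const, Finset.card_powerset, hVcard, nsmul_eq_mul, Nat.cast_pow,
          Nat.cast_ofNat]

end linearforms

section correlation

variable {M : ℕ} [NeZero M]

/-! ### Consequences of the correlation condition: the moment `T_K(ν + 1)` -/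

/-- **Uniform covering by a difference of two vertices**: for `ω ≠ ω'`, `h ↦ ω·h - ω'·h` pushes the
uniform measure of `ℤ_M^k` forward to the uniform measure of `ℤ_M` (some coordinate has
coefficient `±1`). [cite: GreenTaoAnnals2008, §6, end of the proof of Lemma 6.3] -/
theorem expect_vertexDiff_eq {k : ℕ} {ω ω' : Finset (Fin k)} (hne : ω ≠ ω') (Φ : ZMod M → ℝ) :
    (𝔼 h : Fin k → ZMod M, Φ (∑ j ∈ ω, h j - ∑ j ∈ ω', h j)) = 𝔼 n, Φ n := by
  set a : Fin k → ZMod M := fun j => (if j ∈ ω then 1 else 0) - (if j ∈ ω' then 1 else 0) with ha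
  have hsum : ∀ h : Fin k → ZMod M, ∑ j ∈ ω, h j - ∑ j ∈ ω', h j = 0 + ∑ j, a j * h j := by
    intro h
    rw [zero_add, ha]
    simp only [sub_mul, Finset.sum_sub_distrib, ite_mul, one_mul, zero_mul, Finset.sum_ite_mem,
      Finset.univ_inter]
  obtain ⟨j₀, hj₀⟩ : ∃ j, ¬ (j ∈ ω ↔ j ∈ ω') := by
    by_contra hall
    push Not at hall
    exact hne (Finset.ext hall)
  have hunit : IsUnit (a j₀) := by
    rw [ha]
    dsimp only
    by_cases h1 : j₀ ∈ ω
    · have h2 : j₀ ∉ ω' := fun h2 => hj₀ ⟨fun _ => h2, fun _ => h1⟩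
      rw [if_pos h1, if_neg h2, sub_zero]
      exact isUnit_one
    · have h2 : j₀ ∈ ω' := by
        by_contra h2
        exact hj₀ ⟨fun h => absurd h h1, fun h => absurd h h2⟩
      rw [if_neg h1, if_pos h2, zero_sub]
      exact isUnit_one.neg
  simp_rw [hsum]
  exact expect_linear_uniform Φ 0 hunit

/-- **The correlation condition bounds the `K`-th moment of a correlation of `m ≥ 2` cube forms**:
for `S ⊆ {0,1}^k` with `2 ≤ |S| = m ≤ D₀` and `K ≥ 1`,
`𝔼_h (𝔼_y ∏_{ω ∈ S} ν(y + ω·h))^K ≤ (m²)^K max(A(m,K), 0)` (bound the inner average by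
`∑_{i<j} τ_m(ω_i·h - ω_j·h)` (Def. 6.3), take `K`-th powers, and use the uniform covering and the
moment bounds `𝔼 τ_m^K ≤ A(m,K)`). [cite: GreenTaoAnnals2008, §6, end of the proof of Lemma 6.3
("Now we are ready to apply the correlation condition")] [cite: GreenTao2010, Def. 6.3] -/
theorem expect_pow_corr_le {D₀ : ℕ} {A : ℕ → ℝ → ℝ} {ν : ZMod M → ℝ}
    (hCC : CorrelationCondition D₀ A ν) (hν : ∀ x, 0 ≤ ν x) {k : ℕ} {S : Finset (Finset (Fin k))}
    (h2 : 2 ≤ S.card) (hSD : S.card ≤ D₀) {K : ℕ} (hK : 1 ≤ K) :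
    (𝔼 h : Fin k → ZMod M, (𝔼 y, ∏ ω ∈ S, ν (y + ∑ j ∈ ω, h j)) ^ K) ≤
      ((S.card : ℝ) ^ 2) ^ K * max (A S.card K) 0 := by
  have hK1 : K - 1 + 1 = K := Nat.sub_add_cancel hK
  have hK0 : K ≠ 0 := by omega
  set m : ℕ := S.card with hm
  obtain ⟨τ, hτ0, hτmom, hτcorr⟩ := hCC m (by omega) hSD
  have hMcard : (Finset.univ : Finset (ZMod M)).card = M := by rw [Finset.card_univ, ZMod.card]
  -- enumerate `S`
  set e : S ≃ Fin m := S.equivFin with he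
  set HH : (Fin k → ZMod M) → Fin m → ZMod M :=
    fun h i => ∑ l ∈ ((e.symm i : S) : Finset (Fin k)), h l with hHH
  set t : (Fin k → ZMod M) → Fin m × Fin m → ℝ :=
    fun h p => if p.1 < p.2 then τ (HH h p.1 - HH h p.2) else 0 with ht
  have ht0 : ∀ h p, 0 ≤ t h p := fun h p => by
    rw [ht]; dsimp only; split_ifs
    · exact hτ0 _
    · exact le_rfl
  set PP : Finset (Fin m × Fin m) :=
    (Finset.univ : Finset (Fin m)) ×ˢ (Finset.univ : Finset (Fin m)) with hPP
  -- Def. 6.3: the inner average is at most `∑_{i<j} τ(HH_i - HH_j)`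
  have hb : ∀ h : Fin k → ZMod M, (𝔼 y, ∏ ω ∈ S, ν (y + ∑ j ∈ ω, h j)) ≤ ∑ p ∈ PP, t h p := by
    intro h
    have h1 : (𝔼 y, ∏ ω ∈ S, ν (y + ∑ j ∈ ω, h j)) = (∑ y, ∏ i : Fin m, ν (y + HH h i)) / M := by
      rw [Finset.expect_eq_sum_div_card, hMcard]
      congr 1
      refine Finset.sum_congr rfl fun y _ => ?_
      rw [← Finset.prod_coe_sort S, ← Equiv.prod_comp e.symm]
    rw [h1, hPP, Finset.sum_product]
    exact hτcorr (HH h)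
  have hb0 : ∀ h : Fin k → ZMod M, 0 ≤ 𝔼 y, ∏ ω ∈ S, ν (y + ∑ j ∈ ω, h j) := fun h =>
    Finset.expect_nonneg fun y _ => Finset.prod_nonneg fun ω _ => hν _
  -- `K`-th powers (Jensen)
  have hcard2 : PP.card = m * m := by
    rw [hPP, Finset.card_product, Finset.card_univ, Fintype.card_fin]
  have hpow : ∀ h : Fin k → ZMod M, (𝔼 y, ∏ ω ∈ S, ν (y + ∑ j ∈ ω, h j)) ^ K ≤
      ((m : ℝ) * m) ^ (K - 1) * ∑ p ∈ PP, t h p ^ K := by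
    intro h
    refine (pow_le_pow_left₀ (hb0 h) (hb h) _).trans ?_
    have hJ := pow_sum_le_card_mul_sum_pow (s := PP) (f := t h) (fun p _ => ht0 h p) (K - 1)
    rw [hK1, hcard2] at hJ
    exact_mod_cast hJ
  -- average over `h`: each `𝔼_h t_p^K ≤ max(A m K, 0)`
  have hmom : (𝔼 x : ZMod M, τ x ^ K) ≤ max (A m K) 0 := by
    have h1 := hτmom (K : ℝ) (by exact_mod_cast hK)
    simp_rw [Real.rpow_natCast] at h1
    rw [Finset.expect_eq_sum_div_card, hMcard]
    exact h1.trans (le_max_left _ _)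
  have hterm : ∀ p : Fin m × Fin m, (𝔼 h : Fin k → ZMod M, t h p ^ K) ≤ max (A m K) 0 := by
    intro p
    by_cases hp : p.1 < p.2
    · have hne : (((e.symm p.1 : S) : Finset (Fin k))) ≠ ((e.symm p.2 : S) : Finset (Fin k)) := by
        intro heq
        exact (ne_of_lt hp) (e.symm.injective (Subtype.ext heq))
      have h1 : ∀ h : Fin k → ZMod M, t h p ^ K = τ (HH h p.1 - HH h p.2) ^ K := by
        intro h; rw [ht]; dsimp only; rw [if_pos hp]
      simp_rw [h1]
      rw [hHH]
      dsimp only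
      rw [expect_vertexDiff_eq hne (fun x => τ x ^ K)]
      exact hmom
    · have h1 : ∀ h : Fin k → ZMod M, t h p ^ K = 0 := by
        intro h; rw [ht]; dsimp only; rw [if_neg hp, zero_pow hK0]
      simp_rw [h1]
      rw [Fintype.expect_const]
      exact le_max_right _ _
  calc (𝔼 h : Fin k → ZMod M, (𝔼 y, ∏ ω ∈ S, ν (y + ∑ j ∈ ω, h j)) ^ K)
      ≤ 𝔼 h : Fin k → ZMod M, ((m : ℝ) * m) ^ (K - 1) * ∑ p ∈ PP, t h p ^ K :=
        Finset.expect_le_expect fun h _ => hpow h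
    _ = ((m : ℝ) * m) ^ (K - 1) * ∑ p ∈ PP, 𝔼 h : Fin k → ZMod M, t h p ^ K := by
        rw [← Finset.mul_expect, Finset.expect_sum_comm]
    _ ≤ ((m : ℝ) * m) ^ (K - 1) * ∑ _p ∈ PP, max (A m K) 0 :=
        mul_le_mul_of_nonneg_left (Finset.sum_le_sum fun p _ => hterm p) (by positivity)
    _ = ((m : ℝ) ^ 2) ^ K * max (A m K) 0 := by
        rw [Finset.sum_const, hcard2, nsmul_eq_mul, Nat.cast_mul, ← mul_assoc, ← pow_succ, hK1, sq]

/-- The explicit bound of `dualMoment_add_one_le` for `T_K(ν + 1)`, a function of `k, K`, the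
moment constants `A` and the error `η` only. [cite: GreenTaoAnnals2008, Lemma 6.3 ("`O_K(1)`")] -/
def dualMomentBound (k K : ℕ) (A : ℕ → ℝ → ℝ) (η : ℝ) : ℝ :=
  (2 ^ 2 ^ k : ℝ) ^ K *
    ((1 + η) ^ K + ((2 ^ k : ℝ) ^ 2) ^ K * ∑ m ∈ Finset.range (2 ^ k + 1), max (A m K) 0)

/-- `dualMomentBound ≥ 0`. [folklore] -/
theorem dualMomentBound_nonneg (k K : ℕ) (A : ℕ → ℝ → ℝ) {η : ℝ} (hη : 0 ≤ η) :
    0 ≤ dualMomentBound k K A η := by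
  unfold dualMomentBound
  have : 0 ≤ ∑ m ∈ Finset.range (2 ^ k + 1), max (A m K) 0 :=
    Finset.sum_nonneg fun m _ => le_max_right _ _
  positivity

/-- **The moment `T_K(ν + 1)` is `O_{k,K}(1)`** under the `D₀`-correlation condition, `2^k ≤ D₀`,
`K ≥ 1` and `𝔼 ν ≤ 1 + η`: `T_K(ν+1) = 𝔼_h (𝔼_y ∏_ω (ν + 1)(y + ω·h))^K ≤ dualMomentBound k K A η`
(expand the product over subsets `S` of the vertices; `|S| ≤ 1` contributes at most `(1 + η)^K`,
`|S| ≥ 2` is `expect_pow_corr_le`). This is the only use of the correlation condition ("This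
is, in fact, the only time we will use that condition"). [cite: GreenTaoAnnals2008, §6, proof of
Lemma 6.3] [cite: GreenTao2010, Def. 6.3] -/
theorem dualMoment_add_one_le {D₀ : ℕ} {A : ℕ → ℝ → ℝ} {η : ℝ} {ν : ZMod M → ℝ}
    (hCC : CorrelationCondition D₀ A ν) (hν : ∀ x, 0 ≤ ν x) (hE : (𝔼 x, ν x) ≤ 1 + η) (hη : 0 ≤ η)
    {k : ℕ} (h2k : 2 ^ k ≤ D₀) {K : ℕ} (hK : 1 ≤ K) :
    dualMoment k K (fun x => ν x + 1) ≤ dualMomentBound k K A η := by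
  have hK1 : K - 1 + 1 = K := Nat.sub_add_cancel hK
  set b : Finset (Finset (Fin k)) → (Fin k → ZMod M) → ℝ :=
    fun S h => 𝔼 y, ∏ ω ∈ S, ν (y + ∑ j ∈ ω, h j) with hbdef
  have hb0 : ∀ S h, 0 ≤ b S h := fun S h =>
    Finset.expect_nonneg fun y _ => Finset.prod_nonneg fun ω _ => hν _
  set Z : ℝ := ∑ m ∈ Finset.range (2 ^ k + 1), max (A m K) 0 with hZ
  have hZ0 : 0 ≤ Z := Finset.sum_nonneg fun m _ => le_max_right _ _
  set Q : ℝ := (1 + η) ^ K + ((2 ^ k : ℝ) ^ 2) ^ K * Z with hQ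
  have h1η : (1 : ℝ) ≤ (1 + η) ^ K := one_le_pow₀ (by linarith)
  have hXZ : 0 ≤ ((2 ^ k : ℝ) ^ 2) ^ K * Z := mul_nonneg (by positivity) hZ0
  -- expansion of the product over the vertices
  have hexp : ∀ h : Fin k → ZMod M, (𝔼 y, gowersProd k (fun x => ν x + 1) y h) =
      ∑ S : Finset (Finset (Fin k)), b S h := by
    intro h
    unfold gowersProd
    simp_rw [Fintype.prod_add, Finset.prod_const_one, mul_one]
    rw [Finset.expect_sum_comm]
  have hcardS : (Finset.univ : Finset (Finset (Finset (Fin k)))).card = 2 ^ 2 ^ k := by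
    rw [Finset.card_univ, Fintype.card_finset, Fintype.card_finset, Fintype.card_fin]
  -- each `S` contributes at most `Q`
  have hS : ∀ S : Finset (Finset (Fin k)), (𝔼 h : Fin k → ZMod M, b S h ^ K) ≤ Q := by
    intro S
    rcases Nat.lt_or_ge S.card 2 with hlt | hge
    · -- `|S| ≤ 1`: `b_S(h) ≤ 1 + η`
      have hle : ∀ h, b S h ≤ 1 + η := by
        intro h
        rcases S.eq_empty_or_nonempty with rfl | ⟨ω, hω⟩
        · rw [hbdef]; dsimp only
          simp only [Finset.prod_empty, Fintype.expect_const]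
          linarith
        · have hS1 : S = {ω} := Finset.eq_singleton_iff_unique_mem.mpr
            ⟨hω, fun ω' hω' => Finset.card_le_one.mp (by omega) ω' hω' ω hω⟩
          rw [hS1, hbdef]; dsimp only
          simp_rw [Finset.prod_singleton]
          rw [expect_add_right ν (∑ j ∈ ω, h j)]
          exact hE
      calc (𝔼 h : Fin k → ZMod M, b S h ^ K) ≤ 𝔼 _h : Fin k → ZMod M, (1 + η) ^ K :=
            Finset.expect_le_expect fun h _ => pow_le_pow_left₀ (hb0 S h) (hle h) _
        _ = (1 + η) ^ K := Fintype.expect_const _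
        _ ≤ Q := by rw [hQ]; linarith
    · -- `|S| ≥ 2`: the correlation condition
      have hSle : S.card ≤ 2 ^ k := (Finset.card_le_univ S).trans
        (by rw [Fintype.card_finset, Fintype.card_fin])
      have h1 := expect_pow_corr_le hCC hν hge (hSle.trans h2k) hK
      refine h1.trans ?_
      rw [hQ]
      have hmax0 : 0 ≤ max (A S.card K) 0 := le_max_right _ _
      have hmem : S.card ∈ Finset.range (2 ^ k + 1) := Finset.mem_range.mpr (by omega)
      have hsingle : max (A S.card K) 0 ≤ Z :=
        Finset.single_le_sum (f := fun m => max (A m K) 0) (fun m _ => le_max_right _ _) hmem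
      have hcardpow : ((S.card : ℝ) ^ 2) ^ K ≤ ((2 ^ k : ℝ) ^ 2) ^ K := by
        gcongr
        exact_mod_cast hSle
      linarith [mul_le_mul hcardpow hsingle hmax0 (by positivity), h1η]
  -- assemble
  unfold dualMoment
  simp_rw [hexp]
  calc (𝔼 h : Fin k → ZMod M, (∑ S : Finset (Finset (Fin k)), b S h) ^ K)
      ≤ 𝔼 h : Fin k → ZMod M, (2 ^ 2 ^ k : ℝ) ^ (K - 1) * ∑ S : Finset (Finset (Fin k)), b S h ^ K := by
        refine Finset.expect_le_expect fun h _ => ?_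
        have hJ := pow_sum_le_card_mul_sum_pow (s := (Finset.univ : Finset (Finset (Finset (Fin k)))))
          (f := fun S => b S h) (fun S _ => hb0 S h) (K - 1)
        rw [hK1, hcardS] at hJ
        exact_mod_cast hJ
    _ = (2 ^ 2 ^ k : ℝ) ^ (K - 1) * ∑ S : Finset (Finset (Fin k)), 𝔼 h : Fin k → ZMod M, b S h ^ K := by
        rw [← Finset.mul_expect, Finset.expect_sum_comm]
    _ ≤ (2 ^ 2 ^ k : ℝ) ^ (K - 1) * ∑ _S : Finset (Finset (Fin k)), Q :=
        mul_le_mul_of_nonneg_left (Finset.sum_le_sum fun S _ => hS S) (by positivity)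
    _ = dualMomentBound k K A η := by
        rw [Finset.sum_const, hcardS, nsmul_eq_mul, ← mul_assoc]
        unfold dualMomentBound
        rw [← hZ, ← hQ]
        congr 1
        push_cast
        rw [← pow_succ, hK1]

/-- **`ν - 1` is orthogonal to products of dual functions** (the monomial case of Green–Tao 2008,
Prop. 6.2, quantitatively): for a measure `ν ≥ 0` satisfying the `(D₀,D₀,D₀)`-linear forms
condition with error `η ≥ 0` (used only through `𝔼 ν ≤ 1 + η`) and the `D₀`-correlation
condition with moment constants `A`, `2^k ≤ D₀`, and `K = |ι| ≥ 1` vertex families `G_j` with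
`|G_{j,ω}| ≤ ν + 1`,
`|𝔼 (ν - 1) ∏_j 𝒟G_j| ≤ ‖ν - 1‖_{U^k} (2^k - 1)(1 + dualMomentBound k K A η)`; combined with
`‖ν - 1‖_{U^k} = o(1)` (`abs_gowersPower_sub_one_le`) this is `⟨ν - 1, ∏_j 𝒟G_j⟩ = o_K(1)`, the
pseudorandomness hypothesis of the dense model theorem. [cite: GreenTaoAnnals2008, Prop. 6.2 and
Lemma 6.3] -/
theorem abs_expect_sub_one_mul_prod_gdual_le {D₀ : ℕ} {A : ℕ → ℝ → ℝ} {η : ℝ} {ν : ZMod M → ℝ}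
    (hν : ∀ x, 0 ≤ ν x) (hCC : CorrelationCondition D₀ A ν) (hE : (𝔼 x, ν x) ≤ 1 + η)
    (hη : 0 ≤ η) {k : ℕ} (hk : 1 ≤ k) (h2k : 2 ^ k ≤ D₀) {ι : Type*} [Fintype ι] [DecidableEq ι]
    (hι : 1 ≤ Fintype.card ι) (G : ι → Finset (Fin k) → ZMod M → ℝ)
    (hG : ∀ j ω x, |G j ω x| ≤ ν x + 1) :
    |𝔼 x, (ν x - 1) * ∏ j, gdual k (G j) x| ≤
      gowersPower k (fun x => ν x - 1) ^ ((2 ^ k : ℕ) : ℝ)⁻¹ *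
        ((2 ^ k - 1 : ℕ) * (1 + dualMomentBound k (Fintype.card ι) A η)) := by
  refine (abs_expect_mul_prod_gdual_le hk (fun x => ν x - 1) G (νt := fun x => ν x + 1) hG).trans ?_
  refine mul_le_mul_of_nonneg_left ?_ (Real.rpow_nonneg (gowersPower_nonneg hk _) _)
  refine mul_le_mul_of_nonneg_left ?_ (Nat.cast_nonneg _)
  linarith [dualMoment_add_one_le hCC hν hE hη h2k hι]

end correlation


end Literature.NumberTheory.Sieve
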